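import Summits.QuantumFields.YangMills.Theorems.UnitScaleGibbsOnEventHessianAxialGauge
import Literature.MathematicalPhysics.QuantumFieldTheory.Balaban1983to89.Node00.WilsonActionFirstVariationNearFlat
import HarnessLib

/-!
# The first variation of the Wilson action at a near-flat background IS the flat flux pairing `−(1∕N)·Σ_p Re Tr((dY)_p·(V(∂p) − 1))` up to `6·η·θ·Σ_p s_p(Y)`
# (construction C3 of the crux idea «gross-sd-transfer», LINE 28 candidate on `UnitScaleTilt.HistoryTailL`, stmt-QuantumFields-19936 — annex 4 §0: «OBSERVABLE
# `Y(U) := (∂_{u⁰}A_W)(V(U))` … on the good event `= N⁻¹⟨du⁰, F(V)⟩_HS + O(ε)`»; the first-order companion of ✓ `UnitScaleGibbsOnEventHessianAxialGauge`)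

T. Bałaban, *Propagators for lattice gauge theories in a background field*, Commun. Math. Phys. **99** (1985) 389–434 [Balaban1985BackgroundPropagators], (3.6)–(3.7) p. 391 (the LINEAR term
`⟨D^η_{U₀}A, η⁻² Im ∂U₀⟩` of the expansion of the Wilson action at a background); T. Bałaban, *Large field renormalization. II*, Commun. Math. Phys. **122** (1989) 355–392
[Balaban1989LargeFieldII], (1.12) p. 359 (the current `J`), p. 357–358 («in an arbitrary gauge»).

EVERYTHING BELOW IS A KNIT OF LANDED THEOREMS: ✓ `Node00.deriv_wilsonAction4_expChart_zero` (the first variation along `s ↦ expChart V (s•Y)` is `−(1∕N)·Σ_p Re Tr(σ_p·V(∂p))` with the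
TRANSPORTED letter sum `σ_p = 𝕍₁𝕐₁𝕍₁⋆ + (𝕍₁𝕍₂)𝕐₂(𝕍₁𝕍₂)⋆ − (𝕍₁𝕍₂)𝕐₃(𝕍₁𝕍₂)⋆ − (𝕍₁𝕍₂𝕍₃⋆)𝕐₄(𝕍₁𝕍₂𝕍₃⋆)⋆`), ✓ `Node00.re_trace_mul_eq_re_trace_mul_sub_one_of_skew` + `star_transportedSum_eq_neg` (skew letters
pair only with `V(∂p) − 1`), ✓ `Node00.norm_mul_sub_one_le` ∕ `norm_star_sub_one` (deviations add under unitary products), ✓ `MatrixNorms.abs_nReTr_le_opNorm` (B7 (20)), ✓ `T4ReTrLipUnitary.plaqHol_gaugeAct`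
(gauge covariance of plaquette variables) and ✓ `UnitScaleGibbsOnEventHessianAxialGauge` §1∕§4 (axial-gauge bond deviations, the support margin).

WHAT THIS FILE PROVES (kernel; 0 `def`, 0 `sorry`; `GaugeField P j (SU N)`, ANY `Params`∕level; `s_p(Y) = Σ_{k≤4}‖Y_{b_k(p)}‖`; the FLAT PAIRING of a direction `Y` with the curvature deviation is
written out as `−(1∕N)·Σ_p Re Tr((Y₁ + Y₂ − Y₃ − Y₄)·(V(∂p) − 1))`):
* §1 ★ `norm_conj_sub_self_le_two_mul` (`‖gXg⋆ − X‖ ≤ 2‖g − 1‖·‖X‖`), ★ `norm_transportedSum_sub_flat_le`: `‖σ_p − (Y₁ + Y₂ − Y₃ − Y₄)‖ ≤ 6δ·s_p(Y)` when `𝕍₁, 𝕍₂, 𝕍₃` are within `δ` of `1`;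
* §2 ★★★ `abs_deriv_sub_flatPairing_le_local`: for ANY budgets `δ_p` (bond deviations of `V` on `∂p`) and `ε_p ≥ ‖V(∂p) − 1‖`:
  `|d∕ds A_W(expChart V (s•Y))∣₀ − flatPairing(V, Y)| ≤ 6·Σ_p δ_p·ε_p·s_p(Y)`;
* §3 ★★★ `abs_deriv_sub_flatPairing_le_of_bondSmallOn_box` (annex 4 §6's bondwise shape: `V` bondwise `η`-near `1` on the box, plaquette deviations `≤ θ` there, `Y` vanishing off the inner box
  ⇒ `≤ 6·η·θ·Σ_p s_p(Y)`) and ★★★ `abs_deriv_axialGaugeRep_sub_flatPairing_le` (the EVENT form: `PlaqSmallOn (boxPlaqs lo hi) θ U`, `V = U^{axialGauge U lo hi}`, `η = (d−1)·n·θ`).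
HONEST SCOPE.  Deterministic statements about ONE configuration; the identification of `dY` with the test field's least-squares flux (`stub_test`), the `j`-fold linearisation (`stub_lin`), the
SD identity (`stub_condSD`) and the assembly are NOT here; nothing of S_dom ∕ «ShallowFluxSecondMomentL» ∕ (Q) ∕ K1 ∕ `HistoryTailL` is proved; rung R3 (YM₃ on T³) is NOT d = 4, NOT infinite volume,
NOT a mass gap, NOT Clay; the Yang–Mills mass gap is NOT proved.  Width seat ym3-torus-px10 g7; `--supports stmt-QuantumFields-19936 --as helper`.
-/

set_option autoImplicit false

noncomputable section

open scoped BigOperators Matrix.Norms.L2Operator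

namespace Summit.QuantumFields.YangMills.Theorems.UnitScaleGibbsFirstVariationFluxPairing

open Literature.MathematicalPhysics.QuantumFieldTheory.Balaban1983to89
open Literature.MathematicalPhysics.QuantumFieldTheory.Balaban1983to89.T4AdjointCovarianceUnitary (lieSU)
open Literature.MathematicalPhysics.QuantumFieldTheory.Balaban1983to89.T4AxialGaugeSmallField (boxPlaqs boxBonds axialGauge)
open Literature.MathematicalPhysics.QuantumFieldTheory.Balaban1983to89.Node00
  (expChart deriv_wilsonAction4_expChart_zero re_trace_mul_eq_re_trace_mul_sub_one_of_skew star_transportedSum_eq_neg norm_mul_sub_one_le norm_star_sub_one)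
open Summit.QuantumFields.YangMills.Theorems.UnitScaleGibbsOnEventHessianAxialGauge
  (norm_coe_sub_one_le_two norm_gaugeAct_axialGauge_sub_one_le support_hyp_of_vanish_off_inner mem_boxPlaqs_of_bond_mem_inner)

variable {P : Params} {j : ℕ} {N : ℕ}

/-! ## §1 Per-plaquette letters: the transported letter sum against the flat curl -/

section Letters

variable {𝔸 : Type*} [SeminormedAddCommGroup 𝔸]

/-- Four-term bookkeeping: `‖(c₁ + c₂ + −c₃ + −c₄) − (y₁ + y₂ − y₃ − y₄)‖ ≤ Σ‖cᵢ − yᵢ‖`. [folklore] -/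
theorem norm_fourTerm_sub_flat_le (c₁ c₂ c₃ c₄ y₁ y₂ y₃ y₄ : 𝔸) {b₁ b₂ b₃ b₄ : ℝ}
    (h₁ : ‖c₁ - y₁‖ ≤ b₁) (h₂ : ‖c₂ - y₂‖ ≤ b₂) (h₃ : ‖c₃ - y₃‖ ≤ b₃) (h₄ : ‖c₄ - y₄‖ ≤ b₄) :
    ‖(c₁ + c₂ + -c₃ + -c₄) - (y₁ + y₂ - y₃ - y₄)‖ ≤ b₁ + b₂ + b₃ + b₄ := by
  have e : (c₁ + c₂ + -c₃ + -c₄) - (y₁ + y₂ - y₃ - y₄) = (c₁ - y₁) + (c₂ - y₂) - (c₃ - y₃) - (c₄ - y₄) := by abel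
  rw [e]
  calc ‖(c₁ - y₁) + (c₂ - y₂) - (c₃ - y₃) - (c₄ - y₄)‖
      ≤ ‖(c₁ - y₁) + (c₂ - y₂) - (c₃ - y₃)‖ + ‖c₄ - y₄‖ := norm_sub_le _ _
    _ ≤ ‖(c₁ - y₁) + (c₂ - y₂)‖ + ‖c₃ - y₃‖ + ‖c₄ - y₄‖ := by gcongr; exact norm_sub_le _ _
    _ ≤ ‖c₁ - y₁‖ + ‖c₂ - y₂‖ + ‖c₃ - y₃‖ + ‖c₄ - y₄‖ := by gcongr; exact norm_add_le _ _
    _ ≤ b₁ + b₂ + b₃ + b₄ := by gcongr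

end Letters

/-- ★ `‖g X g⋆ − X‖ ≤ 2‖g − 1‖·‖X‖` for unitary `g` (`gXg⋆ − X = (g − 1)Xg⋆ + X(g⋆ − 1)`). [cite: Balaban1985Averaging, (19)–(20) p.21] -/
theorem norm_conj_sub_self_le_two_mul {g : Matrix (Fin N) (Fin N) ℂ} (hg : g ∈ unitary (Matrix (Fin N) (Fin N) ℂ)) (X : Matrix (Fin N) (Fin N) ℂ) :
    ‖g * X * star g - X‖ ≤ 2 * ‖g - 1‖ * ‖X‖ := by
  have e : g * X * star g - X = (g - 1) * X * star g + X * (star g - 1) := by noncomm_ring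
  rw [e]
  calc ‖(g - 1) * X * star g + X * (star g - 1)‖ ≤ ‖(g - 1) * X * star g‖ + ‖X * (star g - 1)‖ := norm_add_le _ _
    _ ≤ ‖g - 1‖ * ‖X‖ + ‖X‖ * ‖star g - 1‖ := by
        rw [CStarRing.norm_mul_mem_unitary _ (Unitary.star_mem hg)]
        exact add_le_add (norm_mul_le _ _) (norm_mul_le _ _)
    _ = 2 * ‖g - 1‖ * ‖X‖ := by rw [norm_star_sub_one]; ring

set_option maxHeartbeats 400000 in
-- hb: the four `gcongr` steps on 4-fold transported matrix words exceed the 100k CI cliff (≈ 150k); decl-local budget per the cell's HEARTBEAT rule.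
/-- ★ **THE TRANSPORTED LETTER SUM AGAINST THE FLAT CURL**: if the bond variables `𝕍₁, 𝕍₂, 𝕍₃` of `∂p` are within `δ` of `1`, then
`‖σ_p(Y,V) − (Y₁ + Y₂ − Y₃ − Y₄)‖ ≤ 6δ·(‖Y₁‖ + ‖Y₂‖ + ‖Y₃‖ + ‖Y₄‖)` (each letter is conjugated by a product of at most three near-`1` unitaries).
[cite: Balaban1985BackgroundPropagators, (3.2) p.390, (3.7) p.391] -/
theorem norm_transportedSum_sub_flat_le (A B C : Matrix.specialUnitaryGroup (Fin N) ℂ) (X₁ X₂ X₃ X₄ : lieSU (Fin N)) {δ : ℝ}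
    (hA : ‖(A : Matrix (Fin N) (Fin N) ℂ) - 1‖ ≤ δ) (hB : ‖(B : Matrix (Fin N) (Fin N) ℂ) - 1‖ ≤ δ) (hC : ‖(C : Matrix (Fin N) (Fin N) ℂ) - 1‖ ≤ δ) :
    ‖((A : Matrix (Fin N) (Fin N) ℂ) * (X₁ : Matrix (Fin N) (Fin N) ℂ) * star (A : Matrix (Fin N) (Fin N) ℂ)
        + (A : Matrix (Fin N) (Fin N) ℂ) * (B : Matrix (Fin N) (Fin N) ℂ) * (X₂ : Matrix (Fin N) (Fin N) ℂ) * star ((A : Matrix (Fin N) (Fin N) ℂ) * (B : Matrix (Fin N) (Fin N) ℂ))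
        + -((A : Matrix (Fin N) (Fin N) ℂ) * (B : Matrix (Fin N) (Fin N) ℂ) * (X₃ : Matrix (Fin N) (Fin N) ℂ) * star ((A : Matrix (Fin N) (Fin N) ℂ) * (B : Matrix (Fin N) (Fin N) ℂ)))
        + -((A : Matrix (Fin N) (Fin N) ℂ) * (B : Matrix (Fin N) (Fin N) ℂ) * star (C : Matrix (Fin N) (Fin N) ℂ) * (X₄ : Matrix (Fin N) (Fin N) ℂ)
            * star ((A : Matrix (Fin N) (Fin N) ℂ) * (B : Matrix (Fin N) (Fin N) ℂ) * star (C : Matrix (Fin N) (Fin N) ℂ))))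
      - ((X₁ : Matrix (Fin N) (Fin N) ℂ) + (X₂ : Matrix (Fin N) (Fin N) ℂ) - (X₃ : Matrix (Fin N) (Fin N) ℂ) - (X₄ : Matrix (Fin N) (Fin N) ℂ))‖
      ≤ 6 * δ * (‖(X₁ : Matrix (Fin N) (Fin N) ℂ)‖ + ‖(X₂ : Matrix (Fin N) (Fin N) ℂ)‖ + ‖(X₃ : Matrix (Fin N) (Fin N) ℂ)‖ + ‖(X₄ : Matrix (Fin N) (Fin N) ℂ)‖) := by
  have uA : (A : Matrix (Fin N) (Fin N) ℂ) ∈ unitary (Matrix (Fin N) (Fin N) ℂ) := A.2.1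
  have uB : (B : Matrix (Fin N) (Fin N) ℂ) ∈ unitary (Matrix (Fin N) (Fin N) ℂ) := B.2.1
  have uC : (C : Matrix (Fin N) (Fin N) ℂ) ∈ unitary (Matrix (Fin N) (Fin N) ℂ) := C.2.1
  have uAB : (A : Matrix (Fin N) (Fin N) ℂ) * (B : Matrix (Fin N) (Fin N) ℂ) ∈ unitary (Matrix (Fin N) (Fin N) ℂ) := mul_mem uA uB
  have uABC : (A : Matrix (Fin N) (Fin N) ℂ) * (B : Matrix (Fin N) (Fin N) ℂ) * star (C : Matrix (Fin N) (Fin N) ℂ) ∈ unitary (Matrix (Fin N) (Fin N) ℂ) :=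
    mul_mem uAB (Unitary.star_mem uC)
  have hδ0 : 0 ≤ δ := (norm_nonneg _).trans hA
  have hAB : ‖(A : Matrix (Fin N) (Fin N) ℂ) * (B : Matrix (Fin N) (Fin N) ℂ) - 1‖ ≤ 2 * δ :=
    (norm_mul_sub_one_le uA _).trans (by linarith)
  have hABC : ‖(A : Matrix (Fin N) (Fin N) ℂ) * (B : Matrix (Fin N) (Fin N) ℂ) * star (C : Matrix (Fin N) (Fin N) ℂ) - 1‖ ≤ 3 * δ := by
    refine (norm_mul_sub_one_le uAB _).trans ?_
    rw [norm_star_sub_one]; linarith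
  have s1 : 0 ≤ ‖(X₁ : Matrix (Fin N) (Fin N) ℂ)‖ := norm_nonneg _
  have s2 : 0 ≤ ‖(X₂ : Matrix (Fin N) (Fin N) ℂ)‖ := norm_nonneg _
  have s3 : 0 ≤ ‖(X₃ : Matrix (Fin N) (Fin N) ℂ)‖ := norm_nonneg _
  have s4 : 0 ≤ ‖(X₄ : Matrix (Fin N) (Fin N) ℂ)‖ := norm_nonneg _
  -- the four conjugation defects
  have e1 := (norm_conj_sub_self_le_two_mul uA (X₁ : Matrix (Fin N) (Fin N) ℂ)).trans
    (show 2 * ‖(A : Matrix (Fin N) (Fin N) ℂ) - 1‖ * ‖(X₁ : Matrix (Fin N) (Fin N) ℂ)‖ ≤ 2 * δ * ‖(X₁ : Matrix (Fin N) (Fin N) ℂ)‖ by gcongr)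
  have e2 := (norm_conj_sub_self_le_two_mul uAB (X₂ : Matrix (Fin N) (Fin N) ℂ)).trans
    (show 2 * ‖(A : Matrix (Fin N) (Fin N) ℂ) * (B : Matrix (Fin N) (Fin N) ℂ) - 1‖ * ‖(X₂ : Matrix (Fin N) (Fin N) ℂ)‖ ≤ 2 * (2 * δ) * ‖(X₂ : Matrix (Fin N) (Fin N) ℂ)‖ by
      gcongr)
  have e3 := (norm_conj_sub_self_le_two_mul uAB (X₃ : Matrix (Fin N) (Fin N) ℂ)).trans
    (show 2 * ‖(A : Matrix (Fin N) (Fin N) ℂ) * (B : Matrix (Fin N) (Fin N) ℂ) - 1‖ * ‖(X₃ : Matrix (Fin N) (Fin N) ℂ)‖ ≤ 2 * (2 * δ) * ‖(X₃ : Matrix (Fin N) (Fin N) ℂ)‖ by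
      gcongr)
  have e4 := (norm_conj_sub_self_le_two_mul uABC (X₄ : Matrix (Fin N) (Fin N) ℂ)).trans
    (show 2 * ‖(A : Matrix (Fin N) (Fin N) ℂ) * (B : Matrix (Fin N) (Fin N) ℂ) * star (C : Matrix (Fin N) (Fin N) ℂ) - 1‖ * ‖(X₄ : Matrix (Fin N) (Fin N) ℂ)‖
        ≤ 2 * (3 * δ) * ‖(X₄ : Matrix (Fin N) (Fin N) ℂ)‖ by gcongr)
  refine (norm_fourTerm_sub_flat_le _ _ _ _ _ _ _ _ e1 e2 e3 e4).trans ?_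
  nlinarith

/-! ## §2 On the lattice: the first variation against the flat flux pairing -/

section Lattice

variable [NeZero N]

/-- Per plaquette: for skew `σ` and any `F, W`: `|(Tr(σ·W)).re − (Tr(F·(W − 1))).re| ≤ N·‖σ − F‖·‖W − 1‖` (skew letters pair only with `W − 1`; B7 (20) `|Re tr M| ≤ ‖M‖`).
[cite: Balaban1985Averaging, (19)–(20) p.21] [cite: Balaban1985BackgroundPropagators, (3.7) p.391] -/
theorem abs_re_trace_sub_re_trace_flat_le {σ : Matrix (Fin N) (Fin N) ℂ} (hσ : star σ = -σ) (F W : Matrix (Fin N) (Fin N) ℂ) :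
    |(Matrix.trace (σ * W)).re - (Matrix.trace (F * (W - 1))).re| ≤ (Fintype.card (Fin N) : ℝ) * (‖σ - F‖ * ‖W - 1‖) := by
  have hN : (0 : ℝ) < (Fintype.card (Fin N) : ℝ) := Nat.cast_pos.mpr (Fintype.card_pos (α := Fin N))
  rw [re_trace_mul_eq_re_trace_mul_sub_one_of_skew hσ W]
  have e : (Matrix.trace (σ * (W - 1))).re - (Matrix.trace (F * (W - 1))).re = (Matrix.trace ((σ - F) * (W - 1))).re := by
    rw [sub_mul, Matrix.trace_sub, Complex.sub_re]
  rw [e]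
  have h := MatrixNorms.abs_nReTr_le_opNorm ((σ - F) * (W - 1))
  unfold UnitaryModel.nReTr at h
  rw [abs_div, Nat.abs_cast, div_le_iff₀ hN] at h
  calc |(Matrix.trace ((σ - F) * (W - 1))).re| ≤ ‖(σ - F) * (W - 1)‖ * (Fintype.card (Fin N) : ℝ) := h
    _ ≤ ‖σ - F‖ * ‖W - 1‖ * (Fintype.card (Fin N) : ℝ) := by gcongr; exact norm_mul_le _ _
    _ = (Fintype.card (Fin N) : ℝ) * (‖σ - F‖ * ‖W - 1‖) := by ring

/-- ★★★ **THE FIRST VARIATION IS THE FLAT FLUX PAIRING UP TO `6·Σ_p δ_p·ε_p·s_p(Y)`** — for ANY configuration `V`, direction `Y`, bond budgets `δ_p` on the three transporting bonds of `∂p`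
(`⟨x,μ⟩, ⟨x+e_μ,ν⟩, ⟨x+e_ν,μ⟩`) and curvature budgets `ε_p ≥ ‖V(∂p) − 1‖`:
`|d∕ds A_W(expChart V (s•Y))∣₀ − (−(1∕N)·Σ_p Re Tr((Y₁+Y₂−Y₃−Y₄)·(V(∂p) − 1)))| ≤ 6·Σ_p δ_p·ε_p·s_p(Y)` — the current `J` of [B16] (1.12) ∕ the linear term of [B9] (3.7) read in FLAT
letters at a near-flat background. [cite: Balaban1985BackgroundPropagators, (3.7) p.391] [cite: Balaban1989LargeFieldII, (1.12) p.359] -/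
theorem abs_deriv_sub_flatPairing_le_local (V : GaugeField P j (Matrix.specialUnitaryGroup (Fin N) ℂ)) (Y : PBond P j → lieSU (Fin N)) (δ ε : Plaq P j → ℝ)
    (hδ : ∀ p : Plaq P j, ‖((V ⟨p.src, p.μ⟩ : Matrix.specialUnitaryGroup (Fin N) ℂ) : Matrix (Fin N) (Fin N) ℂ) - 1‖ ≤ δ p ∧
      ‖((V ⟨p.src.shift p.μ, p.ν⟩ : Matrix.specialUnitaryGroup (Fin N) ℂ) : Matrix (Fin N) (Fin N) ℂ) - 1‖ ≤ δ p ∧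
      ‖((V ⟨p.src.shift p.ν, p.μ⟩ : Matrix.specialUnitaryGroup (Fin N) ℂ) : Matrix (Fin N) (Fin N) ℂ) - 1‖ ≤ δ p)
    (hε : ∀ p : Plaq P j, ‖((GaugeField.plaqHol V p : Matrix.specialUnitaryGroup (Fin N) ℂ) : Matrix (Fin N) (Fin N) ℂ) - 1‖ ≤ ε p) :
    |deriv (fun s : ℝ => wilsonAction4 (expChart V (s • Y))) 0
        - -(∑ p : Plaq P j, (Matrix.trace (((Y ⟨p.src, p.μ⟩ : Matrix (Fin N) (Fin N) ℂ) + (Y ⟨p.src.shift p.μ, p.ν⟩ : Matrix (Fin N) (Fin N) ℂ)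
            - (Y ⟨p.src.shift p.ν, p.μ⟩ : Matrix (Fin N) (Fin N) ℂ) - (Y ⟨p.src, p.ν⟩ : Matrix (Fin N) (Fin N) ℂ))
            * (((GaugeField.plaqHol V p : Matrix.specialUnitaryGroup (Fin N) ℂ) : Matrix (Fin N) (Fin N) ℂ) - 1))).re) / (Fintype.card (Fin N) : ℝ)|
      ≤ 6 * ∑ p : Plaq P j, δ p * ε p * (‖(Y ⟨p.src, p.μ⟩ : Matrix (Fin N) (Fin N) ℂ)‖ + ‖(Y ⟨p.src.shift p.μ, p.ν⟩ : Matrix (Fin N) (Fin N) ℂ)‖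
        + ‖(Y ⟨p.src.shift p.ν, p.μ⟩ : Matrix (Fin N) (Fin N) ℂ)‖ + ‖(Y ⟨p.src, p.ν⟩ : Matrix (Fin N) (Fin N) ℂ)‖) := by
  have hN : (0 : ℝ) < (Fintype.card (Fin N) : ℝ) := Nat.cast_pos.mpr (Fintype.card_pos (α := Fin N))
  rw [deriv_wilsonAction4_expChart_zero]
  rw [show ∀ (a b : Plaq P j → ℝ) (N' : ℝ), -(∑ p, a p) / N' - -(∑ p, b p) / N' = -((∑ p, (a p - b p)) / N') by
    intro a b N'; rw [Finset.sum_sub_distrib]; ring]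
  rw [abs_neg, abs_div, Nat.abs_cast, div_le_iff₀ hN, Finset.mul_sum, Finset.sum_mul]
  refine (Finset.abs_sum_le_sum_abs _ _).trans (Finset.sum_le_sum fun p _ => ?_)
  obtain ⟨h1, h2, h3⟩ := hδ p
  have hskew := star_transportedSum_eq_neg (V ⟨p.src, p.μ⟩) (V ⟨p.src.shift p.μ, p.ν⟩) (V ⟨p.src.shift p.ν, p.μ⟩)
    (Y ⟨p.src, p.μ⟩) (Y ⟨p.src.shift p.μ, p.ν⟩) (Y ⟨p.src.shift p.ν, p.μ⟩) (Y ⟨p.src, p.ν⟩)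
  have hσ := norm_transportedSum_sub_flat_le (V ⟨p.src, p.μ⟩) (V ⟨p.src.shift p.μ, p.ν⟩) (V ⟨p.src.shift p.ν, p.μ⟩)
    (Y ⟨p.src, p.μ⟩) (Y ⟨p.src.shift p.μ, p.ν⟩) (Y ⟨p.src.shift p.ν, p.μ⟩) (Y ⟨p.src, p.ν⟩) h1 h2 h3
  refine (abs_re_trace_sub_re_trace_flat_le hskew _ _).trans ?_
  have hδ0 : 0 ≤ δ p := (norm_nonneg _).trans h1
  have hε0 : 0 ≤ ε p := (norm_nonneg _).trans (hε p)
  have := mul_le_mul hσ (hε p) (norm_nonneg _) (by positivity)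
  nlinarith [this, hN]

end Lattice

/-! ## §3 The box ∕ event forms (annex 4 §6's bondwise hypothesis shape; the axial-gauge representative of a θ-small box) -/

section Box

variable [NeZero N]

open Literature.MathematicalPhysics.QuantumFieldTheory.Balaban1983to89.T4AxialGaugeSmallField (castSite castSite_add_e)
open Literature.MathematicalPhysics.QuantumFieldTheory.Balaban1983to89.B7Prop1Explicit (e)
open Summit.QuantumFields.YangMills.Theorems.UnitScaleGibbsOnEventHessianAxialGauge (e_apply_nonneg)

/-- ★★★ **BONDWISE BOX FORM**: if the bond variables of `V` in `boxBonds lo hi` are within `η` of `1`, its plaquette variables on `boxPlaqs lo hi` within `θ` of `1`, and `Y` vanishes off the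
inner box `boxBonds (lo+1) (hi−1)`, then `|d∕ds A_W(expChart V (s•Y))∣₀ − flatPairing(V, Y)| ≤ 6·η·θ·Σ_p s_p(Y)`. [cite: Balaban1985BackgroundPropagators, (3.7) p.391] [cite: Balaban1989LargeFieldII, (1.12) p.359] -/
theorem abs_deriv_sub_flatPairing_le_of_bondSmallOn_box (V : GaugeField P j (Matrix.specialUnitaryGroup (Fin N) ℂ)) {lo hi : Fin P.d → ℤ} {η θ : ℝ}
    (hV : ∀ b : PBond P j, b ∈ boxBonds lo hi → ‖((V b : Matrix.specialUnitaryGroup (Fin N) ℂ) : Matrix (Fin N) (Fin N) ℂ) - 1‖ ≤ η)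
    (hVp : ∀ p : Plaq P j, p ∈ boxPlaqs lo hi → ‖((GaugeField.plaqHol V p : Matrix.specialUnitaryGroup (Fin N) ℂ) : Matrix (Fin N) (Fin N) ℂ) - 1‖ ≤ θ)
    (Y : PBond P j → lieSU (Fin N)) (hYsupp : ∀ b : PBond P j, b ∉ boxBonds (lo + 1) (hi - 1) → Y b = 0) :
    |deriv (fun s : ℝ => wilsonAction4 (expChart V (s • Y))) 0
        - -(∑ p : Plaq P j, (Matrix.trace (((Y ⟨p.src, p.μ⟩ : Matrix (Fin N) (Fin N) ℂ) + (Y ⟨p.src.shift p.μ, p.ν⟩ : Matrix (Fin N) (Fin N) ℂ)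
            - (Y ⟨p.src.shift p.ν, p.μ⟩ : Matrix (Fin N) (Fin N) ℂ) - (Y ⟨p.src, p.ν⟩ : Matrix (Fin N) (Fin N) ℂ))
            * (((GaugeField.plaqHol V p : Matrix.specialUnitaryGroup (Fin N) ℂ) : Matrix (Fin N) (Fin N) ℂ) - 1))).re) / (Fintype.card (Fin N) : ℝ)|
      ≤ 6 * η * θ * ∑ p : Plaq P j, (‖(Y ⟨p.src, p.μ⟩ : Matrix (Fin N) (Fin N) ℂ)‖ + ‖(Y ⟨p.src.shift p.μ, p.ν⟩ : Matrix (Fin N) (Fin N) ℂ)‖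
        + ‖(Y ⟨p.src.shift p.ν, p.μ⟩ : Matrix (Fin N) (Fin N) ℂ)‖ + ‖(Y ⟨p.src, p.ν⟩ : Matrix (Fin N) (Fin N) ℂ)‖) := by
  classical
  -- a plaquette of the box has its (three transporting) bonds in the box (cf. ✓ `ShellMeasureWilsonGaugeInvariant.bonds_mem_boxBonds`; local re-derivation)
  have hbonds : ∀ p : Plaq P j, p ∈ boxPlaqs lo hi → (⟨p.src, p.μ⟩ : PBond P j) ∈ boxBonds lo hi ∧ (⟨p.src.shift p.μ, p.ν⟩ : PBond P j) ∈ boxBonds lo hi ∧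
      (⟨p.src.shift p.ν, p.μ⟩ : PBond P j) ∈ boxBonds lo hi := by
    rintro p ⟨z, hlo, hhi, hsrc⟩
    have hμ0 := e_apply_nonneg (P := P) p.μ
    have hν0 := e_apply_nonneg (P := P) p.ν
    rw [Pi.le_def] at hlo hhi
    refine ⟨⟨z, Pi.le_def.2 hlo, Pi.le_def.2 fun κ => ?_, hsrc⟩, ⟨z + e p.μ, Pi.le_def.2 fun κ => ?_, Pi.le_def.2 fun κ => ?_, ?_⟩,
      ⟨z + e p.ν, Pi.le_def.2 fun κ => ?_, Pi.le_def.2 fun κ => ?_, ?_⟩⟩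
    · have := hhi κ; simp only [Pi.add_apply] at this ⊢; linarith [hν0 κ]
    · have := hlo κ; simp only [Pi.add_apply]; linarith [hμ0 κ]
    · have := hhi κ; simp only [Pi.add_apply] at this ⊢; linarith
    · rw [hsrc, castSite_add_e]
    · have := hlo κ; simp only [Pi.add_apply]; linarith [hν0 κ]
    · have := hhi κ; simp only [Pi.add_apply] at this ⊢; linarith
    · rw [hsrc, castSite_add_e]
  -- off the box the direction vanishes on `∂p`
  have hzero : ∀ p : Plaq P j, p ∉ boxPlaqs lo hi →
      Y ⟨p.src, p.μ⟩ = 0 ∧ Y ⟨p.src.shift p.μ, p.ν⟩ = 0 ∧ Y ⟨p.src.shift p.ν, p.μ⟩ = 0 ∧ Y ⟨p.src, p.ν⟩ = 0 := by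
    intro p hp
    have key : ∀ b : PBond P j, (b ∈ boxBonds (lo + 1) (hi - 1) → p ∈ boxPlaqs lo hi) → Y b = 0 := fun b hb => by
      by_cases hmem : b ∈ boxBonds (lo + 1) (hi - 1)
      · exact absurd (hb hmem) hp
      · exact hYsupp b hmem
    exact ⟨key _ fun h => mem_boxPlaqs_of_bond_mem_inner (Or.inl h), key _ fun h => mem_boxPlaqs_of_bond_mem_inner (Or.inr (Or.inl h)),
      key _ fun h => mem_boxPlaqs_of_bond_mem_inner (Or.inr (Or.inr (Or.inl h))), key _ fun h => mem_boxPlaqs_of_bond_mem_inner (Or.inr (Or.inr (Or.inr h)))⟩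
  set δ : Plaq P j → ℝ := fun p => if p ∈ boxPlaqs lo hi then η else 2 with hδ
  set ε : Plaq P j → ℝ := fun p => if p ∈ boxPlaqs lo hi then θ else 2 with hε
  have hδb : ∀ p : Plaq P j, ‖((V ⟨p.src, p.μ⟩ : Matrix.specialUnitaryGroup (Fin N) ℂ) : Matrix (Fin N) (Fin N) ℂ) - 1‖ ≤ δ p ∧
      ‖((V ⟨p.src.shift p.μ, p.ν⟩ : Matrix.specialUnitaryGroup (Fin N) ℂ) : Matrix (Fin N) (Fin N) ℂ) - 1‖ ≤ δ p ∧
      ‖((V ⟨p.src.shift p.ν, p.μ⟩ : Matrix.specialUnitaryGroup (Fin N) ℂ) : Matrix (Fin N) (Fin N) ℂ) - 1‖ ≤ δ p := by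
    intro p
    by_cases hp : p ∈ boxPlaqs lo hi
    · have hδp : δ p = η := by rw [hδ]; simp only [hp, ↓reduceIte]
      obtain ⟨hb1, hb2, hb3⟩ := hbonds p hp
      rw [hδp]; exact ⟨hV _ hb1, hV _ hb2, hV _ hb3⟩
    · have hδp : δ p = 2 := by rw [hδ]; simp only [hp, ↓reduceIte]
      rw [hδp]; exact ⟨norm_coe_sub_one_le_two _, norm_coe_sub_one_le_two _, norm_coe_sub_one_le_two _⟩
  have hεb : ∀ p : Plaq P j, ‖((GaugeField.plaqHol V p : Matrix.specialUnitaryGroup (Fin N) ℂ) : Matrix (Fin N) (Fin N) ℂ) - 1‖ ≤ ε p := by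
    intro p
    by_cases hp : p ∈ boxPlaqs lo hi
    · have hεp : ε p = θ := by rw [hε]; simp only [hp, ↓reduceIte]
      rw [hεp]; exact hVp p hp
    · have hεp : ε p = 2 := by rw [hε]; simp only [hp, ↓reduceIte]
      rw [hεp]; exact norm_coe_sub_one_le_two _
  refine (abs_deriv_sub_flatPairing_le_local V Y δ ε hδb hεb).trans ?_
  have hsum : ∑ p : Plaq P j, δ p * ε p * (‖(Y ⟨p.src, p.μ⟩ : Matrix (Fin N) (Fin N) ℂ)‖ + ‖(Y ⟨p.src.shift p.μ, p.ν⟩ : Matrix (Fin N) (Fin N) ℂ)‖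
        + ‖(Y ⟨p.src.shift p.ν, p.μ⟩ : Matrix (Fin N) (Fin N) ℂ)‖ + ‖(Y ⟨p.src, p.ν⟩ : Matrix (Fin N) (Fin N) ℂ)‖)
      ≤ ∑ p : Plaq P j, η * θ * (‖(Y ⟨p.src, p.μ⟩ : Matrix (Fin N) (Fin N) ℂ)‖ + ‖(Y ⟨p.src.shift p.μ, p.ν⟩ : Matrix (Fin N) (Fin N) ℂ)‖
        + ‖(Y ⟨p.src.shift p.ν, p.μ⟩ : Matrix (Fin N) (Fin N) ℂ)‖ + ‖(Y ⟨p.src, p.ν⟩ : Matrix (Fin N) (Fin N) ℂ)‖) := by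
    refine Finset.sum_le_sum fun p _ => ?_
    by_cases hp : p ∈ boxPlaqs lo hi
    · have hδp : δ p = η := by rw [hδ]; simp only [hp, ↓reduceIte]
      have hεp : ε p = θ := by rw [hε]; simp only [hp, ↓reduceIte]
      rw [hδp, hεp]
    · obtain ⟨z1, z2, z3, z4⟩ := hzero p hp
      rw [z1, z2, z3, z4]
      simp
  rw [← Finset.mul_sum] at hsum
  linarith [hsum]

/-- ★★★ **EVENT FORM — ON THE AXIAL-GAUGE REPRESENTATIVE OF A θ-SMALL BOX**: `PlaqSmallOn (boxPlaqs lo hi) θ U` (side `≤ n < sitesPerDir j`), `V := U^{axialGauge U lo hi}` (bonds `(d−1)nθ`-near `1`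
inside, plaquette variables = conjugates of `U`'s, hence `θ`-small), `Y` vanishing off the inner box ⇒ `|d∕ds A_W(expChart V (s•Y))∣₀ − flatPairing(V, Y)| ≤ 6·(d−1)·n·θ·θ·Σ_p s_p(Y)` —
the C3 observable is the flat flux pairing to `O(n·θ²·‖Y‖₁)`. [cite: Balaban1985BackgroundPropagators, (3.7) p.391] [cite: Balaban1989LargeFieldII, (1.12) p.359, p.357–358] -/
theorem abs_deriv_axialGaugeRep_sub_flatPairing_le (U : GaugeField P j (Matrix.specialUnitaryGroup (Fin N) ℂ)) {lo hi : Fin P.d → ℤ} {θ : ℝ} {n : ℕ}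
    (hU : PlaqSmallOn (boxPlaqs lo hi) θ U) (hθ : 0 ≤ θ) (hn : ∀ κ, hi κ ≤ lo κ + n) (hnN : n < P.sitesPerDir j)
    (Y : PBond P j → lieSU (Fin N)) (hYsupp : ∀ b : PBond P j, b ∉ boxBonds (lo + 1) (hi - 1) → Y b = 0) :
    |deriv (fun s : ℝ => wilsonAction4 (expChart (GaugeField.gaugeAct (axialGauge U lo hi) U) (s • Y))) 0
        - -(∑ p : Plaq P j, (Matrix.trace (((Y ⟨p.src, p.μ⟩ : Matrix (Fin N) (Fin N) ℂ) + (Y ⟨p.src.shift p.μ, p.ν⟩ : Matrix (Fin N) (Fin N) ℂ)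
            - (Y ⟨p.src.shift p.ν, p.μ⟩ : Matrix (Fin N) (Fin N) ℂ) - (Y ⟨p.src, p.ν⟩ : Matrix (Fin N) (Fin N) ℂ))
            * (((GaugeField.plaqHol (GaugeField.gaugeAct (axialGauge U lo hi) U) p : Matrix.specialUnitaryGroup (Fin N) ℂ) : Matrix (Fin N) (Fin N) ℂ) - 1))).re)
          / (Fintype.card (Fin N) : ℝ)|
      ≤ 6 * ((((P.d - 1 : ℕ) : ℝ) * n * θ)) * θ * ∑ p : Plaq P j, (‖(Y ⟨p.src, p.μ⟩ : Matrix (Fin N) (Fin N) ℂ)‖ + ‖(Y ⟨p.src.shift p.μ, p.ν⟩ : Matrix (Fin N) (Fin N) ℂ)‖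
        + ‖(Y ⟨p.src.shift p.ν, p.μ⟩ : Matrix (Fin N) (Fin N) ℂ)‖ + ‖(Y ⟨p.src, p.ν⟩ : Matrix (Fin N) (Fin N) ℂ)‖) := by
  refine abs_deriv_sub_flatPairing_le_of_bondSmallOn_box _ (fun b hb => norm_gaugeAct_axialGauge_sub_one_le U hU hθ hn hnN hb)
    (fun p hp => ?_) Y hYsupp
  -- the plaquette variables of the representative are conjugates of those of `U`
  rw [← FederbushMean.dist1_SU_eq, T4ReTrLipUnitary.plaqHol_gaugeAct, GaugeGroup.dist1_conj]
  exact (hU p hp).le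

end Box

end Summit.QuantumFields.YangMills.Theorems.UnitScaleGibbsFirstVariationFluxPairing

end
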